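import Literature.Geometry.Lorentzian.KerrDeSitterRadialTSPolynomialsThreeHalves
import Literature.Geometry.Lorentzian.KerrDeSitterFermionicRealAxis
import HarnessLib

/-!
# Half-integer spin `|s| = 3/2` on the real axis, II: the Teukolsky–Starobinsky conserved form of
# the Kerr–de Sitter radial equation (algebraic core of the `s = 3/2` energy identity)

HONEST LABEL. This file is the ALGEBRAIC CORE of the `s = 3/2` real-axis energy identity: an
explicit Hermitian form `W(r; R, R′)` with polynomial coefficients whose `r`-derivative VANISHES
along every solution of the spin-`3/2` radial Teukolsky equation with real frequency `ω` and real
separation constant `λ` (`hasDerivAt_tsFormThreeHalves`). The mode-exclusion theorem (the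
`|s| = 3/2` twin of `radial_half_real_eq_zero_of_coercive` in `KerrDeSitterFermionicRealAxis.lean`)
needs in addition the two one-sided horizon limits of `W`, which are NOT in this file. Nothing
here bears on nonlinear stability; the object is the separated radial ODE at real `ω`. Definitions
with bodies + theorems, NO named facts.

Sources read verbatim (held texts; page/line of the materialised pages):
* [WuYan2004] S.-Q. Wu, M.-L. Yan, Phys. Rev. D 69 (2004) 044019, arXiv:gr-qc/0303076, Appendix A
  (p. 14 l. 7–35): radial operators `𝒟_n`, `𝒟_n†`, the radial equations (A3)/(A4) and the
  Teukolsky–Starobinsky identities (A5).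
* [Costa2019] R. Teixeira da Costa, Commun. Math. Phys. 378 (2020) 705–781, arXiv:1910.02854:
  Proposition 2.21 (p. 17 l. 30–62), the half-integer energy identity — a conserved sesquilinear
  current built from the Teukolsky–Starobinsky transform, evaluated at the two ends.
* [CasalsTeixeiradacosta2022] M. Casals, R. Teixeira da Costa, Commun. Math. Phys. 394 (2022)
  797–832: Theorem 3.10, second bullet, and its printed proof for half-integer `s` (p. 17 l. 56):
  "By the same method [the Teukolsky–Starobinsky identities], one may deduce that if `|s| ≤ 2` is
  half-integer, the energy identity implies that in fact `u ≡ 0` holds independently of `ω`."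

## What is here

* `hasDerivAt_tsHermitianForm` — an ABSTRACT pointwise conservation lemma (any spin `s`): data
  `D, A, P = P_r + iP_i, C` with derivatives `D₁, A′, P′, C′` at `r` and numbers `N = N_r + iN_i`
  satisfying (P1) `D·A′ = 2(P_rN_r + P_iN_i)`, (P2) `A + D·P′ = s·D₁·P + C·N`,
  (P3) `2P_r + D·C′ = 2s·D₁·C`, and `R` with `D²R″ + (s+1)DD₁R′ + NR = 0` at `r`
  ⟹ `d/dy [A|R|² + 2Re(D·P·R·conj R′) + D²C|R′|²] = 0` at `r` (the architecture of
  `radial_half_real_eq_zero_of_coercive`: a complex sesquilinear `F` with `W = Re F`, product rule,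
  elimination of `R″`, one `linear_combination`).
* `tsqForm`, `hasDerivAt_tsqForm` — the spin-`3/2` form for a generic even quartic `Δ` and even
  quadratic `K̃`, with the polynomial data and the four identities of the companion file
  `KerrDeSitterRadialTSPolynomialsThreeHalves.lean`.
* Kerr–de Sitter: `radialPotential_threeHalves_mul_delta` (for real `ω`, `λ` the tree's spin-`3/2`
  coefficient satisfies `Δ_r·V = N_V` with `d₀ = a²`, `d₁ = −2M`, `d₂ = 1 − Λa²/3`, `d₄ = −Λ/3`,
  `k₀ = Ξ(ωa² − am)`, `k₂ = Ξω`, `λ̃ = λ + (1 − α)/3`; uses `6iΞωr = 3i(ΞK)′` and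
  `−(20Λ/3)r² + 3(1−α) = (5/3)Δ_r″ − (1−α)/3`), the form `tsFormThreeHalves M a Λ ω m λ r u v`,
  and THE THEOREM OF THIS FILE `hasDerivAt_tsFormThreeHalves`: along any pointwise solution of
  `Δ_r R″ + (5/2)Δ_r′R′ + V_{3/2}R = 0` with `Im ω = Im λ = 0` and `Δ_r(r) ≠ 0`, the function
  `y ↦ W(y; R(y), R′(y))` has derivative `0` at `r` (`hasDerivAt_tsFormThreeHalves_of_solution`:
  at every point of `(r₊, r_c)` for an `IsRadialTeukolskySolution` witness triple on subextremal
  Kerr–de Sitter). This is the `|s| = 3/2` counterpart of the constancy of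
  `Q = λΔ|R|² − |ΔR′ + (Δ′/2 + iΞK)R|²` at `|s| = 1/2`.

What is NOT here: the horizon limits of `W` on the ingoing branch at `r₊` and the outgoing branch at
`r_c` (cell pub-kds checked in exact rational arithmetic that they are
`−ℭ_{3/2}(λ)Δ′(r₊)/(4β₊² + 1/4)·|f(r₊)|²` and `Δ′(r_c)⁴(4β_c² + 1/4)(4β_c² + 9/4)·|g(r_c)|²`,
`β_h = ΞK(r_h)/Δ′(r_h)`, `ℭ_{3/2}` = `tsRadialConstantThreeHalves`; no declaration below claims
this), and hence no statement about radial solutions vanishing.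
-/

noncomputable section

open Complex Set Filter Topology

open scoped ComplexConjugate

namespace Literature.Geometry.Lorentzian.KerrDeSitter

/-! ### An abstract conservation lemma for Teukolsky–Starobinsky-type Hermitian forms -/

/-- **Abstract conservation lemma (any spin `s`).** Let `D, A, P_r, P_i, C : ℝ → ℝ` be
differentiable at `r` with derivatives `D₁, A′, P_r′, P_i′, C′`, `D(r) ≠ 0`, and let the real
numbers `N_r, N_i` and these data satisfy, AT the point `r`, the four identities
(P1) `D·A′ = 2(P_r N_r + P_i N_i)`, (P2) `A + D·P′ = s·D₁·P + C·N` (real and imaginary parts,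
`P = P_r + iP_i`, `N = N_r + iN_i`), (P3) `2P_r + D·C′ = 2s·D₁·C`. If `R` is twice differentiable
at `r` and `D²R″ + (s+1)D·D₁R′ + N·R = 0` there, then the Hermitian form
`y ↦ A(y)|R(y)|² + 2 Re(D(y)P(y)·R(y)·conj R′(y)) + D(y)²C(y)|R′(y)|²` has derivative `0` at `r`:
its derivative times `D` is `(P1)|R|² + D(P2)R conj R′ + D·conj(P2) R′ conj R + D²(P3)|R′|²`
modulo the equation and its conjugate. (This is the pointwise algebra of the Teukolsky–Starobinsky
energy current, isolated from any particular spin or background.)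
[cite: Costa2019, Proposition 2.21] -/
theorem hasDerivAt_tsHermitianForm {s : ℝ} {D A Pr Pi C : ℝ → ℝ} {D₁ Ad Prd Pid Cd Nr Ni : ℝ}
    {R R' R'' : ℝ → ℂ} {r : ℝ} (hD0 : D r ≠ 0)
    (hD : HasDerivAt D D₁ r) (hA : HasDerivAt A Ad r) (hPr : HasDerivAt Pr Prd r)
    (hPi : HasDerivAt Pi Pid r) (hC : HasDerivAt C Cd r)
    (i1 : D r * Ad = 2 * (Pr r * Nr + Pi r * Ni))
    (i2r : A r + D r * Prd = s * D₁ * Pr r + C r * Nr)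
    (i2i : D r * Pid = s * D₁ * Pi r + C r * Ni)
    (i3 : 2 * Pr r + D r * Cd = 2 * s * D₁ * C r)
    (h1 : HasDerivAt R (R' r) r) (h2 : HasDerivAt R' (R'' r) r)
    (heq : (D r : ℂ) ^ 2 * R'' r + (s + 1 : ℂ) * (D r : ℂ) * (D₁ : ℂ) * R' r +
      ((Nr : ℂ) + I * (Ni : ℂ)) * R r = 0) :
    HasDerivAt (fun y => A y * normSq (R y) +
      2 * ((D y : ℂ) * ((Pr y : ℂ) + I * (Pi y : ℂ)) * R y * conj (R' y)).re +
      D y ^ 2 * C y * normSq (R' y)) 0 r := by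
  have hDc : (D r : ℂ) ≠ 0 := by exact_mod_cast hD0
  -- the identities, cast to `ℂ` and packaged with `P = P_r + iP_i`, `N = N_r + iN_i`
  have i1c : (D r : ℂ) * (Ad : ℂ) = 2 * ((Pr r : ℂ) * (Nr : ℂ) + (Pi r : ℂ) * (Ni : ℂ)) := by
    exact_mod_cast i1
  have i2rc : (A r : ℂ) + (D r : ℂ) * (Prd : ℂ) = (s : ℂ) * (D₁ : ℂ) * (Pr r : ℂ) +
      (C r : ℂ) * (Nr : ℂ) := by
    exact_mod_cast i2r
  have i2ic : (D r : ℂ) * (Pid : ℂ) = (s : ℂ) * (D₁ : ℂ) * (Pi r : ℂ) + (C r : ℂ) * (Ni : ℂ) := by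
    exact_mod_cast i2i
  have i3c : 2 * (Pr r : ℂ) + (D r : ℂ) * (Cd : ℂ) = 2 * (s : ℂ) * (D₁ : ℂ) * (C r : ℂ) := by
    exact_mod_cast i3
  have ci1 : (D r : ℂ) * (Ad : ℂ) =
      ((Pr r : ℂ) + I * (Pi r : ℂ)) * ((Nr : ℂ) - I * (Ni : ℂ)) +
        ((Pr r : ℂ) - I * (Pi r : ℂ)) * ((Nr : ℂ) + I * (Ni : ℂ)) := by
    linear_combination i1c + (2 * (Pi r : ℂ) * (Ni : ℂ)) * I_sq
  have ci2 : (A r : ℂ) + (D r : ℂ) * ((Prd : ℂ) + I * (Pid : ℂ)) =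
      (s : ℂ) * (D₁ : ℂ) * ((Pr r : ℂ) + I * (Pi r : ℂ)) +
        (C r : ℂ) * ((Nr : ℂ) + I * (Ni : ℂ)) := by
    linear_combination i2rc + I * i2ic
  have ci2b : (A r : ℂ) + (D r : ℂ) * ((Prd : ℂ) - I * (Pid : ℂ)) =
      (s : ℂ) * (D₁ : ℂ) * ((Pr r : ℂ) - I * (Pi r : ℂ)) +
        (C r : ℂ) * ((Nr : ℂ) - I * (Ni : ℂ)) := by
    linear_combination i2rc - I * i2ic
  have ci3 : ((Pr r : ℂ) + I * (Pi r : ℂ)) + ((Pr r : ℂ) - I * (Pi r : ℂ)) +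
      (D r : ℂ) * (Cd : ℂ) = 2 * (s : ℂ) * (D₁ : ℂ) * (C r : ℂ) := by
    linear_combination i3c
  -- the conjugate equation
  have heqb : (D r : ℂ) ^ 2 * conj (R'' r) + (s + 1 : ℂ) * (D r : ℂ) * (D₁ : ℂ) * conj (R' r) +
      ((Nr : ℂ) - I * (Ni : ℂ)) * conj (R r) = 0 := by
    have h := congrArg conj heq
    simp only [map_add, map_mul, map_pow, conj_ofReal, conj_I, map_zero, map_one] at h
    linear_combination h
  -- derivatives of the coefficient functions (complex-valued) and of `conj R`, `conj R′`
  have hDd : HasDerivAt (fun y => (D y : ℂ)) ((D₁ : ℝ) : ℂ) r := hD.ofReal_comp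
  have hAc : HasDerivAt (fun y => (A y : ℂ)) ((Ad : ℝ) : ℂ) r := hA.ofReal_comp
  have hPrc : HasDerivAt (fun y => (Pr y : ℂ)) ((Prd : ℝ) : ℂ) r := hPr.ofReal_comp
  have hPic : HasDerivAt (fun y => (Pi y : ℂ)) ((Pid : ℝ) : ℂ) r := hPi.ofReal_comp
  have hCc : HasDerivAt (fun y => (C y : ℂ)) ((Cd : ℝ) : ℂ) r := hC.ofReal_comp
  have hRb : HasDerivAt (fun y => conj (R y)) (conj (R' r)) r := by simpa using h1.star
  have hR'b : HasDerivAt (fun y => conj (R' y)) (conj (R'' r)) r := by simpa using h2.star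
  have h12 : HasDerivAt (fun y => (D y : ℂ) * ((Pr y : ℂ) + I * (Pi y : ℂ)))
      ((D₁ : ℂ) * ((Pr r : ℂ) + I * (Pi r : ℂ)) + (D r : ℂ) * ((Prd : ℂ) + I * (Pid : ℂ))) r :=
    hDd.fun_mul (hPrc.fun_add (hPic.const_mul I))
  have h21 : HasDerivAt (fun y => (D y : ℂ) * ((Pr y : ℂ) - I * (Pi y : ℂ)))
      ((D₁ : ℂ) * ((Pr r : ℂ) - I * (Pi r : ℂ)) + (D r : ℂ) * ((Prd : ℂ) - I * (Pid : ℂ))) r :=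
    hDd.fun_mul (hPrc.fun_sub (hPic.const_mul I))
  have h22 : HasDerivAt (fun y => (D y : ℂ) * (D y : ℂ) * (C y : ℂ))
      (((D₁ : ℂ) * (D r : ℂ) + (D r : ℂ) * (D₁ : ℂ)) * (C r : ℂ) +
        (D r : ℂ) * (D r : ℂ) * (Cd : ℂ)) r :=
    (hDd.fun_mul hDd).fun_mul hCc
  -- the complex (real-valued) form `F` and its derivative
  have hF : HasDerivAt (fun y => (A y : ℂ) * (R y * conj (R y)) +
      (D y : ℂ) * ((Pr y : ℂ) + I * (Pi y : ℂ)) * (R y * conj (R' y)) +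
      (D y : ℂ) * ((Pr y : ℂ) - I * (Pi y : ℂ)) * (R' y * conj (R y)) +
      (D y : ℂ) * (D y : ℂ) * (C y : ℂ) * (R' y * conj (R' y)))
      ((Ad : ℂ) * (R r * conj (R r)) + (A r : ℂ) * (R' r * conj (R r) + R r * conj (R' r)) +
        (((D₁ : ℂ) * ((Pr r : ℂ) + I * (Pi r : ℂ)) + (D r : ℂ) * ((Prd : ℂ) + I * (Pid : ℂ))) *
            (R r * conj (R' r)) +
          (D r : ℂ) * ((Pr r : ℂ) + I * (Pi r : ℂ)) * (R' r * conj (R' r) + R r * conj (R'' r))) +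
        (((D₁ : ℂ) * ((Pr r : ℂ) - I * (Pi r : ℂ)) + (D r : ℂ) * ((Prd : ℂ) - I * (Pid : ℂ))) *
            (R' r * conj (R r)) +
          (D r : ℂ) * ((Pr r : ℂ) - I * (Pi r : ℂ)) * (R'' r * conj (R r) + R' r * conj (R' r))) +
        ((((D₁ : ℂ) * (D r : ℂ) + (D r : ℂ) * (D₁ : ℂ)) * (C r : ℂ) +
            (D r : ℂ) * (D r : ℂ) * (Cd : ℂ)) * (R' r * conj (R' r)) +
          (D r : ℂ) * (D r : ℂ) * (C r : ℂ) * (R'' r * conj (R' r) + R' r * conj (R'' r)))) r := by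
    have t1 := hAc.fun_mul (h1.fun_mul hRb)
    have t2 := h12.fun_mul (h1.fun_mul hR'b)
    have t3 := h21.fun_mul (h2.fun_mul hRb)
    have t4 := h22.fun_mul (h2.fun_mul hR'b)
    exact ((t1.fun_add t2).fun_add t3).fun_add t4
  -- its value vanishes
  have hval : (D r : ℂ) * ((Ad : ℂ) * (R r * conj (R r)) +
      (A r : ℂ) * (R' r * conj (R r) + R r * conj (R' r)) +
        (((D₁ : ℂ) * ((Pr r : ℂ) + I * (Pi r : ℂ)) + (D r : ℂ) * ((Prd : ℂ) + I * (Pid : ℂ))) *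
            (R r * conj (R' r)) +
          (D r : ℂ) * ((Pr r : ℂ) + I * (Pi r : ℂ)) * (R' r * conj (R' r) + R r * conj (R'' r))) +
        (((D₁ : ℂ) * ((Pr r : ℂ) - I * (Pi r : ℂ)) + (D r : ℂ) * ((Prd : ℂ) - I * (Pid : ℂ))) *
            (R' r * conj (R r)) +
          (D r : ℂ) * ((Pr r : ℂ) - I * (Pi r : ℂ)) * (R'' r * conj (R r) + R' r * conj (R' r))) +
        ((((D₁ : ℂ) * (D r : ℂ) + (D r : ℂ) * (D₁ : ℂ)) * (C r : ℂ) +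
            (D r : ℂ) * (D r : ℂ) * (Cd : ℂ)) * (R' r * conj (R' r)) +
          (D r : ℂ) * (D r : ℂ) * (C r : ℂ) *
            (R'' r * conj (R' r) + R' r * conj (R'' r)))) = 0 := by
    linear_combination (R r * conj (R r)) * ci1 + ((D r : ℂ) * (R r * conj (R' r))) * ci2 +
      ((D r : ℂ) * (R' r * conj (R r))) * ci2b + ((D r : ℂ) ^ 2 * (R' r * conj (R' r))) * ci3 +
      (((Pr r : ℂ) - I * (Pi r : ℂ)) * conj (R r) + (D r : ℂ) * (C r : ℂ) * conj (R' r)) * heq +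
      (((Pr r : ℂ) + I * (Pi r : ℂ)) * R r + (D r : ℂ) * (C r : ℂ) * R' r) * heqb
  rw [(mul_eq_zero.1 hval).resolve_left hDc] at hF
  -- `W = Re F`
  have hWF : (fun y => A y * normSq (R y) +
      2 * ((D y : ℂ) * ((Pr y : ℂ) + I * (Pi y : ℂ)) * R y * conj (R' y)).re +
      D y ^ 2 * C y * normSq (R' y)) = fun y =>
      ((A y : ℂ) * (R y * conj (R y)) +
        (D y : ℂ) * ((Pr y : ℂ) + I * (Pi y : ℂ)) * (R y * conj (R' y)) +
        (D y : ℂ) * ((Pr y : ℂ) - I * (Pi y : ℂ)) * (R' y * conj (R y)) +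
        (D y : ℂ) * (D y : ℂ) * (C y : ℂ) * (R' y * conj (R' y))).re := by
    funext y
    simp only [add_re, mul_re, mul_im, add_im, sub_re, sub_im, conj_re, conj_im, ofReal_re,
      ofReal_im, I_re, I_im, normSq_apply]
    ring
  rw [hWF]
  simpa only [Function.comp_def, reCLM_apply, zero_re] using
    (reCLM.hasFDerivAt.comp_hasDerivAt r hF)

/-! ### The conserved Hermitian form (generic even quartic) -/

/-- **The spin-`3/2` Teukolsky–Starobinsky form** (generic even-dominated quartic `Δ`, even
quadratic `K̃`): `W(r; u, v) := p₁₁(r)|u|² + 2 Re(Δ(r)p₁₂(r)·u·conj v) + Δ(r)²p₂₂(r)|v|²`, to be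
evaluated at `(u, v) = (R(r), R′(r))` — Abel's invariant `Δ^{5/2}(R R̂′ − R′R̂)` of the spin-`3/2`
radial equation paired with the Teukolsky–Starobinsky transform `R̂ = 𝒟₀³(Δ^{3/2} conj R)`, reduced
modulo the equation. [cite: Costa2019, Proposition 2.21] -/
def tsqForm (d₀ d₁ d₂ d₄ k₀ k₂ el r : ℝ) (u v : ℂ) : ℝ :=
  tsqP11 d₀ d₁ d₂ d₄ k₀ k₂ el r * normSq u +
    2 * ((tsqDelta d₀ d₁ d₂ d₄ r : ℂ) *
      ((tsqP12re d₀ d₁ d₂ d₄ k₀ k₂ el r : ℂ) + I * (tsqP12im d₀ d₁ d₂ d₄ k₀ k₂ el r : ℂ)) *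
        u * conj v).re +
    tsqDelta d₀ d₁ d₂ d₄ r ^ 2 * tsqP22 d₀ d₁ d₂ d₄ k₀ k₂ el r * normSq v

/-- **Conservation of the spin-`3/2` Teukolsky–Starobinsky form (generic coefficients).** If `R` is
twice differentiable at `r` with derivatives `R′(r)`, `R″(r)`, `Δ(r) ≠ 0`, and the spin-`3/2` radial
equation holds at `r` in the polynomial form `Δ²R″ + (5/2)ΔΔ′R′ + N_V R = 0`,
`N_V = Re N_V + i Im N_V` (`tsqNVre`, `tsqNVim`: real frequency and separation constant), then
`y ↦ W(y; R(y), R′(y))` has derivative `0` at `r` (`hasDerivAt_tsHermitianForm` with the four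
identities `tsq_identity_P1/P2re/P2im/P3`). [cite: WuYan2004, Appendix A, (A5)] -/
theorem hasDerivAt_tsqForm {d₀ d₁ d₂ d₄ k₀ k₂ el : ℝ} {R R' R'' : ℝ → ℂ} {r : ℝ}
    (hΔ : tsqDelta d₀ d₁ d₂ d₄ r ≠ 0) (h1 : HasDerivAt R (R' r) r) (h2 : HasDerivAt R' (R'' r) r)
    (heq : (tsqDelta d₀ d₁ d₂ d₄ r : ℂ) ^ 2 * R'' r +
      5 / 2 * (tsqDelta d₀ d₁ d₂ d₄ r : ℂ) * (tsqDeltaD d₁ d₂ d₄ r : ℂ) * R' r +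
        ((tsqNVre d₀ d₁ d₂ d₄ k₀ k₂ el r : ℂ) + I * (tsqNVim d₀ d₁ d₂ d₄ k₀ k₂ r : ℂ)) * R r =
          0) :
    HasDerivAt (fun y => tsqForm d₀ d₁ d₂ d₄ k₀ k₂ el y (R y) (R' y)) 0 r := by
  have heq' : (tsqDelta d₀ d₁ d₂ d₄ r : ℂ) ^ 2 * R'' r +
      ((3 / 2 : ℝ) + 1 : ℂ) * (tsqDelta d₀ d₁ d₂ d₄ r : ℂ) * (tsqDeltaD d₁ d₂ d₄ r : ℂ) * R' r +
        ((tsqNVre d₀ d₁ d₂ d₄ k₀ k₂ el r : ℂ) + I * (tsqNVim d₀ d₁ d₂ d₄ k₀ k₂ r : ℂ)) * R r =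
          0 := by
    push_cast
    linear_combination heq
  have h := hasDerivAt_tsHermitianForm (s := 3 / 2) hΔ (hasDerivAt_tsqDelta d₀ d₁ d₂ d₄ r)
    (hasDerivAt_tsqP11 d₀ d₁ d₂ d₄ k₀ k₂ el r) (hasDerivAt_tsqP12re d₀ d₁ d₂ d₄ k₀ k₂ el r)
    (hasDerivAt_tsqP12im d₀ d₁ d₂ d₄ k₀ k₂ el r) (hasDerivAt_tsqP22 d₀ d₁ d₂ d₄ k₀ k₂ el r)
    (tsq_identity_P1 d₀ d₁ d₂ d₄ k₀ k₂ el r) (tsq_identity_P2re d₀ d₁ d₂ d₄ k₀ k₂ el r)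
    (tsq_identity_P2im d₀ d₁ d₂ d₄ k₀ k₂ el r)
    (by linear_combination tsq_identity_P3 d₀ d₁ d₂ d₄ k₀ k₂ el r) h1 h2 heq'
  exact h

/-! ### Kerr–de Sitter: the data of the tree's spin-`3/2` radial equation at real `ω`, `λ` -/

/-- `k₀ = Ξ(Re ω·a² − am)`, the constant coefficient of `K̃ = ΞK` (real frequency).
[cite: Hatsuda2020, (2.14)] -/
def kdsK0 (a Λ : ℝ) (ω : ℂ) (m : ℝ) : ℝ := xi a Λ * (ω.re * a ^ 2 - a * m)

/-- `k₂ = Ξ·Re ω`, the `r²`-coefficient of `K̃ = ΞK` (real frequency).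
[cite: Hatsuda2020, (2.14)] -/
def kdsK2 (a Λ : ℝ) (ω : ℂ) : ℝ := xi a Λ * ω.re

/-- `λ̃ = Re λ + (1 − α)/3`, the shifted separation constant for which the spin-`3/2` coefficient
reads `V = (K̃² − (3i/2)K̃Δ′)/Δ + 3iK̃′ + (5/3)Δ″ − λ̃`. [cite: SuzukiTakasugiUmetsu1998, (3.7)] -/
def kdsEl (a Λ : ℝ) (lam : ℂ) : ℝ := lam.re + (1 - alpha a Λ) / 3

/-- The tree's `Δ_r` is the even-dominated quartic with `d₀ = a²`, `d₁ = −2M`, `d₂ = 1 − Λa²/3`,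
`d₄ = −Λ/3`. [cite: Hatsuda2020, (2.13)] -/
theorem delta_eq_tsqDelta (M a Λ r : ℝ) :
    delta M a Λ r = tsqDelta (a ^ 2) (-(2 * M)) (1 - Λ / 3 * a ^ 2) (-(Λ / 3)) r := by
  simp only [delta, tsqDelta]
  ring

/-- `Δ_r′` in the same coefficients. [cite: Hatsuda2020, (2.13)] -/
theorem deltaDeriv_eq_tsqDeltaD (M a Λ r : ℝ) :
    deltaDeriv M a Λ r = tsqDeltaD (-(2 * M)) (1 - Λ / 3 * a ^ 2) (-(Λ / 3)) r := by
  simp only [deltaDeriv, tsqDeltaD]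
  ring

/-- **The spin-`3/2` radial coefficient, regrouped.** For real `ω` and real `λ`,
`Δ·V_{3/2} = N_V = Re N_V + i·Im N_V` with `Re N_V = K̃² + Δ((5/3)Δ″ − λ̃)` and
`Im N_V = −(3/2)K̃Δ′ + 3ΔK̃′`, `K̃ = ΞK`, `λ̃ = λ + (1 − α)/3` (uses `6iΞωr = 3iK̃′` and
`−(20Λ/3)r² + 3(1 − α) = (5/3)Δ″ − (1 − α)/3`). [cite: SuzukiTakasugiUmetsu1998, (3.7)] -/
theorem radialPotential_threeHalves_mul_delta (M a Λ : ℝ) {ω : ℂ} (hω : ω.im = 0) (m : ℝ)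
    {lam : ℂ} (hlam : lam.im = 0) {r : ℝ} (hΔ : delta M a Λ r ≠ 0) :
    radialPotential M a Λ (3 / 2) ω m lam r * (delta M a Λ r : ℂ) =
      (tsqNVre (a ^ 2) (-(2 * M)) (1 - Λ / 3 * a ^ 2) (-(Λ / 3)) (kdsK0 a Λ ω m) (kdsK2 a Λ ω)
          (kdsEl a Λ lam) r : ℂ) +
        I * (tsqNVim (a ^ 2) (-(2 * M)) (1 - Λ / 3 * a ^ 2) (-(Λ / 3)) (kdsK0 a Λ ω m)
          (kdsK2 a Λ ω) r : ℂ) := by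
  have hΔc : (delta M a Λ r : ℂ) ≠ 0 := by exact_mod_cast hΔ
  have hωr : ω = ((ω.re : ℝ) : ℂ) := Complex.ext (by simp) (by simp [hω])
  have hlamr : lam = ((lam.re : ℝ) : ℂ) := Complex.ext (by simp) (by simp [hlam])
  have step : radialPotential M a Λ (3 / 2) ω m lam r * (delta M a Λ r : ℂ) =
      ((xi a Λ : ℂ) ^ 2 * radialK a ω m r ^ 2 -
          I * ((3 / 2 : ℝ) : ℂ) * (xi a Λ : ℂ) * radialK a ω m r * (deltaDeriv M a Λ r : ℂ)) +
        (4 * I * ((3 / 2 : ℝ) : ℂ) * (xi a Λ : ℂ) * ω * (r : ℂ) -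
            ((2 * Λ / 3 * (3 / 2 + 1) * (2 * (3 / 2) + 1) * r ^ 2 : ℝ) : ℂ) +
            ((2 * (3 / 2) * (1 - alpha a Λ) : ℝ) : ℂ) - lam) * (delta M a Λ r : ℂ) := by
    unfold radialPotential
    field_simp
    ring
  rw [step, hωr, hlamr]
  simp only [kdsK0, kdsK2, kdsEl, tsqNVre, tsqNVim, tsqK, tsqDelta, tsqDeltaD, tsqDeltaDD, radialK,
    delta, deltaDeriv, xi, alpha, ofReal_re]
  push_cast
  ring

/-- **The `|s| = 3/2` Teukolsky–Starobinsky form of Kerr–de Sitter** at frequency `ω` and separation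
constant `λ` (their real parts enter): `W(r; u, v) = p₁₁|u|² + 2Re(Δ_r p₁₂ u conj v) + Δ_r² p₂₂|v|²`
with the generic polynomials evaluated at `d₀ = a²`, `d₁ = −2M`, `d₂ = 1 − Λa²/3`, `d₄ = −Λ/3`,
`k₀ = Ξ(Re ω a² − am)`, `k₂ = Ξ Re ω`, `λ̃ = Re λ + (1 − α)/3`; to be evaluated at
`(u, v) = (R(r), R′(r))` for a spin-`3/2` radial function `R`.
[cite: Costa2019, Proposition 2.21] -/
def tsFormThreeHalves (M a Λ : ℝ) (ω : ℂ) (m : ℝ) (lam : ℂ) (r : ℝ) (u v : ℂ) : ℝ :=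
  tsqForm (a ^ 2) (-(2 * M)) (1 - Λ / 3 * a ^ 2) (-(Λ / 3)) (kdsK0 a Λ ω m) (kdsK2 a Λ ω)
    (kdsEl a Λ lam) r u v

/-- **Conservation law of the spin-`3/2` radial Teukolsky equation on Kerr–de Sitter at real
frequency (algebraic core of the `s = 3/2` energy identity).** If `Im ω = 0`, `Im λ = 0`,
`Δ_r(r) ≠ 0`, and `R` is twice differentiable at `r` with `Δ_r R″ + (5/2)Δ_r′R′ + V_{3/2}R = 0`
there (the pointwise content of `IsRadialTeukolskySolution M a Λ (3/2) ω m λ R`), then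
`y ↦ W(y; R(y), R′(y))` (`tsFormThreeHalves`) has derivative `0` at `r`. This is the `|s| = 3/2`
counterpart of the constancy of `Q = λΔ|R|² − |ΔR′ + (Δ′/2 + iΞK)R|²` at `|s| = 1/2`
(`hasDerivAt_tsPartner_half`); the horizon limits needed for the mode-exclusion statement are not
part of this declaration. [cite: WuYan2004, Appendix A, (A5); Costa2019, Proposition 2.21;
CasalsTeixeiradacosta2022, Theorem 3.10] -/
theorem hasDerivAt_tsFormThreeHalves {M a Λ : ℝ} {ω : ℂ} {m : ℝ} {lam : ℂ} {R R' R'' : ℝ → ℂ}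
    {r : ℝ} (hω : ω.im = 0) (hlam : lam.im = 0) (hΔ : delta M a Λ r ≠ 0)
    (h1 : HasDerivAt R (R' r) r) (h2 : HasDerivAt R' (R'' r) r)
    (heq : (delta M a Λ r : ℂ) * R'' r + ((3 / 2 + 1 : ℝ) : ℂ) * (deltaDeriv M a Λ r : ℂ) * R' r +
      radialPotential M a Λ (3 / 2) ω m lam r * R r = 0) :
    HasDerivAt (fun y => tsFormThreeHalves M a Λ ω m lam y (R y) (R' y)) 0 r := by
  have hΔ' : tsqDelta (a ^ 2) (-(2 * M)) (1 - Λ / 3 * a ^ 2) (-(Λ / 3)) r ≠ 0 := by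
    rwa [← delta_eq_tsqDelta]
  have hV := radialPotential_threeHalves_mul_delta M a Λ hω m hlam hΔ
  have heq2 : (tsqDelta (a ^ 2) (-(2 * M)) (1 - Λ / 3 * a ^ 2) (-(Λ / 3)) r : ℂ) ^ 2 * R'' r +
      5 / 2 * (tsqDelta (a ^ 2) (-(2 * M)) (1 - Λ / 3 * a ^ 2) (-(Λ / 3)) r : ℂ) *
          (tsqDeltaD (-(2 * M)) (1 - Λ / 3 * a ^ 2) (-(Λ / 3)) r : ℂ) * R' r +
        ((tsqNVre (a ^ 2) (-(2 * M)) (1 - Λ / 3 * a ^ 2) (-(Λ / 3)) (kdsK0 a Λ ω m) (kdsK2 a Λ ω)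
              (kdsEl a Λ lam) r : ℂ) +
          I * (tsqNVim (a ^ 2) (-(2 * M)) (1 - Λ / 3 * a ^ 2) (-(Λ / 3)) (kdsK0 a Λ ω m)
              (kdsK2 a Λ ω) r : ℂ)) * R r = 0 := by
    rw [← delta_eq_tsqDelta, ← deltaDeriv_eq_tsqDeltaD, ← hV]
    have h := congrArg (fun z => z * (delta M a Λ r : ℂ)) heq
    simp only [zero_mul] at h
    push_cast at h
    linear_combination h
  exact hasDerivAt_tsqForm hΔ' h1 h2 heq2

/-- **Along a radial Teukolsky solution the form is locally constant**: for a classical solution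
`R` of the spin-`3/2` radial equation on `(r₊, r_c)` of subextremal Kerr–de Sitter (where `Δ_r > 0`)
with real `ω` and `λ`, and its derivative witness `R′`, the function `r ↦ W(r; R(r), R′(r))` has
derivative `0` at every point of `(r₊, r_c)`. [cite: Costa2019, Proposition 2.21] -/
theorem hasDerivAt_tsFormThreeHalves_of_solution {M a Λ : ℝ} {ω : ℂ} {m : ℝ} {lam : ℂ}
    (hsub : IsSubextremal M a Λ) (hω : ω.im = 0) (hlam : lam.im = 0) {R R' R'' : ℝ → ℂ}
    (hode : ∀ r ∈ Ioo (rPlus M a Λ) (rCosmo M a Λ),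
      HasDerivAt R (R' r) r ∧ HasDerivAt R' (R'' r) r ∧
        (delta M a Λ r : ℂ) * R'' r + ((3 / 2 + 1 : ℝ) : ℂ) * (deltaDeriv M a Λ r : ℂ) * R' r +
            radialPotential M a Λ (3 / 2) ω m lam r * R r = 0) :
    ∀ r ∈ Ioo (rPlus M a Λ) (rCosmo M a Λ),
      HasDerivAt (fun y => tsFormThreeHalves M a Λ ω m lam y (R y) (R' y)) 0 r := by
  intro r hr
  obtain ⟨-, -, -, -, -, -, -, hΔpos, -⟩ := hsub
  obtain ⟨h1, h2, heq⟩ := hode r hr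
  exact hasDerivAt_tsFormThreeHalves hω hlam (hΔpos r hr).ne' h1 h2 heq

end Literature.Geometry.Lorentzian.KerrDeSitter

end
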